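import Summits.CriticalPhenomena.PercolationContinuityZ3.Theorems.FK.DLRSandwich
import Summits.CriticalPhenomena.PercolationContinuityZ3.Theorems.FK.UniquenessCriticalFKIsing
import Summits.CriticalPhenomena.PercolationContinuityZ3.Theorems.FK.CriticalPointBounds
import HarnessLib

/-!
# FK-continuity cell, FO-10a: `|R_{p,q}| = 1` when the wired phase does not percolate — Grimmett 2006, Thm. (5.33)(a)
# for the DLR class, the subcritical phase, the critical point under `T_W(q)`, and critical FK–Ising (`q = 2`, `d ≥ 3`)

Registered R75 (cell INBOX l.5563, 2026-08-23); registry row FO-10a-g335d; label DLS-D (coordinator fk-4 g153).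
Cell `fk-continuity` (bschramm), row FO-10a; support file for the FK-continuity transplant
(`--supports stmt-CriticalPhenomena-4575`); builds on p205010 (kernel theorem, internal audit signed; external expert
review pending). Pure proofs; no definitions, no named facts, no sorries.

`DLRSandwich.lean` (`IsDLRRandomCluster → FKGibbs`, `0 < p < 1`) composed with FO-10a-g335
(`UniquenessOfNonPercolationTheta.lean`: `θ¹(p,q) = 0 ⇒` the sandwich class is `{φ⁰_{p,q}}`): every DLR random-cluster
measure carried by lattice configurations EQUALS `φ⁰_{p,q}` when `θ¹(p,q) = 0` — Grimmett 2006, Thm. (5.33)(a) with the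
remark after it ("[8, Thm A.2] … a unique random-cluster measure throughout the subcritical phase"), now for the class
`R_{p,q}` of Def. (4.29) itself (`|R_{p,q}| = 1`), and conversely `φ⁰_{p,q} ∈ R_{p,q}` (FO-06b-6
`isDLRRandomCluster_rcLimit`):

* `IsDLRRandomCluster.eq_rcLimit_false_of_thetaWired_eq_zero`, `isDLRRandomCluster_and_ae_iff_eq_rcLimit_false`;
* `IsDLRRandomCluster.eq_rcLimit_false_of_lt_rcCriticalProb` (`0 < p < p_c(q)`);
* `IsDLRRandomCluster.eq_rcLimit_false_of_fkContinuityWired` (at `p_c(q)`, `d ≥ 2`, under `T_W(q)`: a unique critical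
  DLR measure — Conj. (5.34)(ii) "if");
* `IsDLRRandomCluster.eq_rcLimit_false_rcCriticalProb_two` — `q = 2`, `d ≥ 3`: **the critical FK–Ising DLR state on `ℤ^d`
  is unique** (ADS 2015 through FO-10a-g335's NPC-D).

## References

* G. Grimmett, *The Random-Cluster Model*, Springer 2006: Def. (4.29), Thm. (4.31), Thm. (5.33)(a) and the remark after
  it, Conj. (5.34)(ii) [PDF pp. 81–82, 107]. [Grimmett2006]
* M. Aizenman, J. T. Chayes, L. Chayes, C. M. Newman, J. Stat. Phys. 50 (1988), Thm. A.2. [AizenmanChayesChayesNewman1988]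
-/

noncomputable section

open MeasureTheory Set Filter
open scoped Topology ENNReal

namespace Summit.CriticalPhenomena.PercolationContinuityZ3.Theorems.FK

open Literature.Probability.Percolation Literature.Probability.LatticeModels
open Literature.Barriers.CriticalPhenomena

variable {d : ℕ} {p q : ℝ} {P : Measure (BondConfig (Site d))}

/-- **Grimmett 2006, Thm. (5.33)(a) for the DLR class**: if `θ¹(p,q) = 0` (`0 < p < 1`, `q ≥ 1`), every DLR random-cluster
measure carried by lattice configurations is `φ⁰_{p,q}` — `|R_{p,q}| = 1`. [cite: Grimmett2006, Thm. (5.33)(a) and the remark after it] -/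
theorem IsDLRRandomCluster.eq_rcLimit_false_of_thetaWired_eq_zero (hP : IsDLRRandomCluster d p q P)
    (hE : ∀ᵐ ω ∂P, ω ⊆ (zdGraph d).edgeSet) (hp : p ∈ Set.Ioo (0 : ℝ) 1) (hq : 1 ≤ q) (hθ : thetaWired d p q = 0) :
    P = rcLimit d false p q :=
  (hP.fkGibbs hp hq hE).eq_rcLimit_false_of_thetaWired_eq_zero ⟨hp.1.le, hp.2.le⟩ hq hθ

/-- **`R_{p,q} = {φ⁰_{p,q}}` when `θ¹(p,q) = 0`**: a probability measure is a lattice-carried DLR random-cluster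
measure iff it is `φ⁰_{p,q}` (`0 < p < 1`, `q ≥ 1`). [cite: Grimmett2006, Thm. (5.33)(a) with Thm. (4.31)/(4.34)(b)] -/
theorem isDLRRandomCluster_and_ae_iff_eq_rcLimit_false (hp : p ∈ Set.Ioo (0 : ℝ) 1) (hq : 1 ≤ q)
    (hθ : thetaWired d p q = 0) :
    (IsDLRRandomCluster d p q P ∧ ∀ᵐ ω ∂P, ω ⊆ (zdGraph d).edgeSet) ↔ P = rcLimit d false p q := by
  have hp' : p ∈ Set.Icc (0 : ℝ) 1 := ⟨hp.1.le, hp.2.le⟩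
  refine ⟨fun h => h.1.eq_rcLimit_false_of_thetaWired_eq_zero h.2 hp hq hθ, fun h => ?_⟩
  subst h
  exact ⟨isDLRRandomCluster_rcLimit false hp' hq, ((isBoxLimit_rcLimit false hp' hq).fkGibbs hp' hq).ae_subset_edgeSet⟩

/-- **A unique DLR random-cluster measure throughout the subcritical phase**: for `0 < p < p_c(q)` (`q ≥ 1`), every
lattice-carried DLR measure is `φ⁰_{p,q}`. [cite: Grimmett2006, remark after Thm. (5.33) (p. 107)] -/
theorem IsDLRRandomCluster.eq_rcLimit_false_of_lt_rcCriticalProb (hP : IsDLRRandomCluster d p q P)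
    (hE : ∀ᵐ ω ∂P, ω ⊆ (zdGraph d).edgeSet) (hq : 1 ≤ q) (hp0 : 0 < p) (hlt : p < rcCriticalProb d q) :
    P = rcLimit d false p q :=
  hP.eq_rcLimit_false_of_thetaWired_eq_zero hE ⟨hp0, hlt.trans_le (rcCriticalProb_mem_Icc d q).2⟩ hq
    (thetaWired_eq_zero_of_lt_rcCriticalProb hq hp0.le hlt)

/-- **Under `T_W(q)` the critical DLR measure is unique** (`d ≥ 2`, `q ≥ 1`): every lattice-carried DLR random-cluster
measure at `p_c(q)` is `φ⁰_{p_c(q),q}` (Conj. (5.34)(ii) "if", for the class `R`). [cite: Grimmett2006, Conj. (5.34)(ii) with Thm. (5.33)(a)] -/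
theorem IsDLRRandomCluster.eq_rcLimit_false_of_fkContinuityWired (hd : 2 ≤ d) (hq : 1 ≤ q) (h : FKContinuityWired d q)
    (hP : IsDLRRandomCluster d (rcCriticalProb d q) q P) (hE : ∀ᵐ ω ∂P, ω ⊆ (zdGraph d).edgeSet) :
    P = rcLimit d false (rcCriticalProb d q) q :=
  hP.eq_rcLimit_false_of_thetaWired_eq_zero hE ⟨rcCriticalProb_pos (by omega) hq, rcCriticalProb_lt_one hd hq⟩ hq h

/-- **The critical FK–Ising DLR state on `ℤ^d`, `d ≥ 3`, is unique**: every lattice-carried DLR random-cluster measure at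
`(p_c(2), 2)` equals `φ⁰_{p_c(2),2}` (ADS 2015 via FO-10a-g335 NPC-D / FO-01 `wired_two`; corollary import of the in-tree ADS
chain). [cite: Grimmett2006, Conj. (5.34)(ii) with Thm. (5.33)(a)] [cite: AizenmanDuminilCopinSidoraviciusCMP2015, Thm. 1.2 with Cor. 1.5 (1)] -/
theorem IsDLRRandomCluster.eq_rcLimit_false_rcCriticalProb_two (hd : 3 ≤ d)
    (hP : IsDLRRandomCluster d (rcCriticalProb d 2) 2 P) (hE : ∀ᵐ ω ∂P, ω ⊆ (zdGraph d).edgeSet) :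
    P = rcLimit d false (rcCriticalProb d 2) 2 :=
  hP.eq_rcLimit_false_of_fkContinuityWired (by omega) (by norm_num) (wired_two hd) hE

end Summit.CriticalPhenomena.PercolationContinuityZ3.Theorems.FK

end
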